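import Literature.NumberTheory.Automorphic.BrandtEigenvectorNonEisenstein
import Literature.NumberTheory.Automorphic.BrandtXiSetupIndependence
import Literature.NumberTheory.Automorphic.BrandtSetupAdmissible
import Literature.NumberTheory.EllipticCurves.NonEisensteinPrimeOfSurjective
import Literature.NumberTheory.EllipticCurves.TakahashiDegreeFormulaProofs
import Literature.NumberTheory.Automorphic.PollackWestonCongruence
import HarnessLib

/-!
# Pollack–Weston 2011, Thm. 6.8 for a prime `N⁻`: the non-Eisenstein step, and the degree formula
# `ord_p δ = ord_p ξ(E; M, r) + ord_p(ord_r Δ_min)` from the character-group dictionary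

Topic `Literature/NumberTheory/EllipticCurves`; theorems only (no definition, no named fact, no
instance). Sibling of `RibetTakahashiDefinite.lean` (the congruence-number form of PW Thm. 6.8
from the named fact `PollackWeston2011.thm_6_8_ellipticCurve`) and of
`TakahashiDegreeFormulaProofs.lean` (Takahashi 2001 Thm. 2.3 from the character-group dictionary,
`takahashi2001_thm_2_3_of_brandtDictionary`).

Source (R. Pollack, T. Weston, *On anticyclotomic μ-invariants of modular forms*, Compositio
Math. 147 (2011), `lit read arxiv:math/0610694`, PDF pp. 14–15). The printed proof of **Thm. 6.8**
(`ord_𝔭(η_f(N)/ξ_f(N⁺,N⁻)) = Σ_{ℓ ∣ N⁻} t_f(ℓ)`) combines Prop. 6.5 [Kohel]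
(`Pic(X_{N⁺,N⁻}) ⊗ 𝒪 ≅ 𝒳_r(N⁺r, N⁻/r)`, pairings matched), **Prop. 6.6** [Takahashi]
(`ord_𝔭 δ_f(N₁,N₂) = t_f(r) + ord_𝔭⟨g_r, g_r⟩_J` for `r ∣ N₁`), Prop. 6.7 and Ribet–Takahashi. For a
PRIME `N⁻ = r` only `(N₁,N₂) = (N,1)`, `J = J₀(N)`, is involved, Ribet–Takahashi is empty, and
Prop. 6.6 is Takahashi's Thm. 2.3, `δ · i_r = h_r · j_r` with `i_r j_r = c_r` (tree:
`Takahashi2001.exists_index_formula`), together with the one place where hypothesis **CR (i)**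
(`ρ̄_f` surjective) enters: Prop. 6.4 (1) / 6.3 (2) — "[Khare]": after localisation at the
non-Eisenstein `𝔪_f` the image of `Φ_r(J) → Φ_r(A)` is trivial (Ribet 1990 Thm. 3.12:
`Φ_r(J₀(N))` is Eisenstein), i.e. **`p ∤ i_r`**, whence `ord_p j_r = ord_p c_r = t_f(r)` and
`ord_p δ = t_f(r) + ord_p h_r`.

This file PROVES that step on the definite side, and assembles the prime-`N⁻` degree formula
from exactly the geometric dictionary already isolated for Takahashi's theorem:

* `PollackWeston.exists_not_dvd_weight_mul_sub`, `….exists_sum_eq_zero_not_dvd_pairing` — **CR (i)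
  makes the `a(E)`-eigenvector non-Eisenstein modulo `p` in every Brandt setup** of type
  `(N⁺, N⁻)` with `N⁺N⁻ = N_E`, `p ≥ 5`: for `v` in the eigen-lattice with `p ∤ v`, some
  `w_c v_c - w_{c'} v_{c'}` is prime to `p`, i.e. `p ∤ ⟨v, y⟩` for a degree-zero `y` — by the
  Brandt-module Eisenstein criterion (`Brandt.XiSetup.exists_not_dvd_weight_mul_sub`: weight
  symmetry, Eichler's column sums `ℓ + 1`, `p ∤ w_c`) fed with a good prime `ℓ ∤ p N_E` having
  `a_ℓ(E) ≢ ℓ + 1 (mod p)` (`exists_prime_not_dvd_lFunction_sub_of_hasSurjectiveModNGaloisRep`: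
  Chebotarev + Brauer–Nesbitt, proved in the tree). UNCONDITIONAL.
* `PollackWeston.not_dvd_generator_range_pairing` — hence, in the dictionary of
  `TakahashiDegreeFormulaProofs` with `X = ℤ[Cls O]⁰` (Ribet's isometry
  `X_r(J₀(rM)) ≅ ℤ[Cls O]⁰`), **`p ∤ i_r`** for the positive generator `i_r` of
  `{⟨g_r, y⟩ : y ∈ X}` (Takahashi Lemma 2.2; PW Prop. 6.4 (1)).
* `PollackWeston.factorization_modularDegree_of_brandtData` — **PW Thm. 6.8 (degree form) for
  prime `N⁻ = r`, for one curve and one setup, from the dictionary**: with the data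
  `(X = ℤ[Cls O]⁰, π^*, π_*, g, j)` of `Takahashi2001.exists_ij_of_brandtData` and `ρ̄_{E,p}`
  surjective, `p ≥ 5`:
  `ord_p(deg P) = ord_p ξ_S(E; M, r) + ord_p(ord_r Δ_min(E))`. Neither CR (ii) nor `p ∤ N` is
  needed in this case (they enter PW's proof only through Thm. 6.2 / Prop. 6.7 and Ribet–Takahashi).
* `PollackWeston.thm_6_8_prime_of_brandtDictionary` — the same universally: **the conclusion of
  `PollackWeston2011.thm_6_8_ellipticCurve` for every prime `N⁻ = r`** (in its `brandtXi` /
  `Σ_{q ∣ r}` shape) follows from the character-group dictionary `H` — the hypothesis of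
  `takahashi2001_thm_2_3_of_brandtDictionary` with the one extra clause that `X` is the
  degree-zero sublattice (as printed: Ribet 1990 Prop. 3.1, Takahashi 2001 p. 84) — and
  `takahashi2001_thm_2_3_of_brandtDictionary_degreeZero` records that this `H` still yields
  Takahashi's fact. So for prime `N⁻` the two named facts rest on the SAME missing input
  (Néron models / character groups (M1)–(M2), Ribet's isometry (M4), multiplicity one (M5)).

## References

* [PollackWeston2011] R. Pollack, T. Weston, Compositio Math. 147 (2011) 1353–1381, §6.2
  Props. 6.3–6.4, §6.4 Prop. 6.6, §6.5 Thm. 6.8 (PDF pp. 14–15). READ.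
* [Takahashi2001] S. Takahashi, J. Number Theory 90 (2001), Lemma 2.2, Thm. 2.3, p. 84.
* [Ribet1990] K. Ribet, Invent. Math. 100 (1990), §3: Prop. 3.1 (character group = degree-zero
  divisors on the supersingular points) and Thm. 3.12 (`Φ` is Eisenstein).
* [Khare2003] C. Khare, On isomorphisms between deformation rings and Hecke rings, Invent. Math.
  154 (2003) (cited by PW for Props. 6.3–6.4).
-/

noncomputable section

open scoped BigOperators

namespace Literature.NumberTheory.EllipticCurves

open Literature.NumberTheory.Automorphic Literature.NumberTheory.EllipticCurves.ModularForms

namespace PollackWeston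

/-! ### CR (i) makes the `a(E)`-eigenvector non-Eisenstein modulo `p` -/

/-- **CR (i) ⇒ the `a(E)`-eigenvector is non-Eisenstein mod `p`.** Let `E/ℚ` (model `W`) have
conductor `N_E = N⁺N⁻`, let `S` be a Brandt setup of type `(N⁺, N⁻)`, `p ≥ 5` a prime with
`ρ̄_{E,p}` surjective, and `v` a vector of the `a(E)`-eigen-lattice of the Brandt matrices with
`p ∤ v_{c₀}`. Then `p ∤ w_c v_c - w_{c'} v_{c'}` for some classes `c, c'`. (A good prime
`ℓ ∤ p N_E` with `a_ℓ(E) ≢ ℓ + 1 (mod p)` exists by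
`exists_prime_not_dvd_lFunction_sub_of_hasSurjectiveModNGaloisRep`; apply the Brandt-module
criterion `Brandt.XiSetup.exists_not_dvd_weight_mul_sub`.) This is the definite-side content of
"`𝔪_f` is non-Eisenstein, so `Φ̂_r(J)_{𝔪_f} = 0`" in PW Prop. 6.3 (2) / 6.4 (1).
[cite: PollackWeston2011, Prop. 6.3–6.4 (PDF p. 14)] [cite: Ribet1990, §3 Thm. 3.12] -/
theorem exists_not_dvd_weight_mul_sub (W : WeierstrassCurve ℚ) [W.IsElliptic] {Nplus Nminus : ℕ}
    (hN : W.conductorNorm ℤ = Nplus * Nminus) {p : ℕ} [Fact p.Prime] (h5 : 5 ≤ p)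
    (hsurj : W.HasSurjectiveModNGaloisRep (p : ℤ)) (S : Brandt.XiSetup Nplus Nminus)
    [Fintype (Brandt.ClassSet S.O)] {v : Brandt.ClassSet S.O → ℤ}
    (hv : v ∈ Brandt.eigenLattice (Nplus * Nminus) (Brandt.matrix S.O) fun n => W.LFunction n)
    {c₀ : Brandt.ClassSet S.O} (hv0 : ¬ (p : ℤ) ∣ v c₀) :
    ∃ c c' : Brandt.ClassSet S.O,
      ¬ (p : ℤ) ∣ (Brandt.weight S.O c : ℤ) * v c - (Brandt.weight S.O c' : ℤ) * v c' := by
  obtain ⟨ℓ, hℓ, -, hℓN, hne⟩ :=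
    exists_prime_not_dvd_lFunction_sub_of_hasSurjectiveModNGaloisRep W p hsurj
  rw [hN] at hℓN
  exact S.exists_not_dvd_weight_mul_sub hv Fact.out h5 hv0 hℓ hℓN hne

/-- **Degree-zero form**: under the same hypotheses there is `y ∈ ℤ[Cls O]⁰` (`Σ_c y_c = 0`) with
`p ∤ ⟨v, y⟩ = Σ_c w_c v_c y_c` — the functional `u_J(v, ·)` on the character group
`X_r(J₀(rM)) ≅ ℤ[Cls O]⁰` (Ribet 1990 Prop. 3.1) is non-zero modulo `p`.
[cite: PollackWeston2011, Prop. 6.4 (1)] [cite: Ribet1990, §3] -/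
theorem exists_sum_eq_zero_not_dvd_pairing (W : WeierstrassCurve ℚ) [W.IsElliptic]
    {Nplus Nminus : ℕ} (hN : W.conductorNorm ℤ = Nplus * Nminus) {p : ℕ} [Fact p.Prime]
    (h5 : 5 ≤ p) (hsurj : W.HasSurjectiveModNGaloisRep (p : ℤ)) (S : Brandt.XiSetup Nplus Nminus)
    [Fintype (Brandt.ClassSet S.O)] [DecidableEq (Brandt.ClassSet S.O)]
    {v : Brandt.ClassSet S.O → ℤ}
    (hv : v ∈ Brandt.eigenLattice (Nplus * Nminus) (Brandt.matrix S.O) fun n => W.LFunction n)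
    {c₀ : Brandt.ClassSet S.O} (hv0 : ¬ (p : ℤ) ∣ v c₀) :
    ∃ y : Brandt.ClassSet S.O → ℤ, ∑ c, y c = 0 ∧
      ¬ (p : ℤ) ∣ ∑ c, (Brandt.weight S.O c : ℤ) * v c * y c := by
  obtain ⟨ℓ, hℓ, -, hℓN, hne⟩ :=
    exists_prime_not_dvd_lFunction_sub_of_hasSurjectiveModNGaloisRep W p hsurj
  rw [hN] at hℓN
  exact S.exists_sum_eq_zero_not_dvd_pairing hv Fact.out h5 hv0 hℓ hℓN hne

/-- **Generator form**: if the `a(E)`-eigen-lattice is the line `ℤ g` (`g ≠ 0`; multiplicity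
one), then `g` is non-Eisenstein mod `p`: `p ∤ w_c g_c - w_{c'} g_{c'}` for some `c, c'`
(`g` is primitive, `Brandt.exists_not_dvd_of_eigenLattice_eq_span`). [cite: PollackWeston2011, Prop. 6.4 (1)] -/
theorem exists_not_dvd_weight_mul_sub_of_eq_span (W : WeierstrassCurve ℚ) [W.IsElliptic]
    {Nplus Nminus : ℕ} (hN : W.conductorNorm ℤ = Nplus * Nminus) {p : ℕ} [Fact p.Prime]
    (h5 : 5 ≤ p) (hsurj : W.HasSurjectiveModNGaloisRep (p : ℤ)) (S : Brandt.XiSetup Nplus Nminus)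
    [Fintype (Brandt.ClassSet S.O)] {g : Brandt.ClassSet S.O → ℤ} (hg : g ≠ 0)
    (hL : Brandt.eigenLattice (Nplus * Nminus) (Brandt.matrix S.O) (fun n => W.LFunction n) =
      ℤ ∙ g) :
    ∃ c c' : Brandt.ClassSet S.O,
      ¬ (p : ℤ) ∣ (Brandt.weight S.O c : ℤ) * g c - (Brandt.weight S.O c' : ℤ) * g c' := by
  obtain ⟨c₀, hc₀⟩ := Brandt.exists_not_dvd_of_eigenLattice_eq_span hg hL (Fact.out : p.Prime)
  exact exists_not_dvd_weight_mul_sub W hN h5 hsurj S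
    (hL ▸ Submodule.mem_span_singleton_self g) hc₀

/-! ### `p ∤ i_r`: the generator of `{⟨g, y⟩ : y ∈ ℤ[Cls O]⁰}` is prime to `p` -/

/-- **`p ∤ i_r`** (Pollack–Weston Prop. 6.4 (1) / Takahashi Lemma 2.2 on the definite side). In a
Brandt setup `S` of type `(N⁺, N⁻)`, `N⁺N⁻ = N_E`, let `X ⊆ ℤ^{Cls O}` be the degree-zero
sublattice, `g ∈ X` a generator of the `a(E)`-eigen-line, and `i` an integer dividing every
pairing `⟨g, y⟩ = Σ_c w_c g_c y_c`, `y ∈ X` (e.g. the generator `i_r` of that ideal). If `ρ̄_{E,p}`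
is surjective and `p ≥ 5`, then `p ∤ i`. [cite: PollackWeston2011, Prop. 6.4 (1) (PDF p. 14)] [cite: Takahashi2001, Lemma 2.2] -/
theorem not_dvd_generator_range_pairing (W : WeierstrassCurve ℚ) [W.IsElliptic]
    {Nplus Nminus : ℕ} (hN : W.conductorNorm ℤ = Nplus * Nminus) {p : ℕ} [Fact p.Prime]
    (h5 : 5 ≤ p) (hsurj : W.HasSurjectiveModNGaloisRep (p : ℤ)) (S : Brandt.XiSetup Nplus Nminus)
    [Fintype (Brandt.ClassSet S.O)] (X : Submodule ℤ (Brandt.ClassSet S.O → ℤ))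
    (hX : ∀ y, y ∈ X ↔ ∑ c, y c = 0) {g : Brandt.ClassSet S.O → ℤ} (hg : g ≠ 0)
    (hL : Brandt.eigenLattice (Nplus * Nminus) (Brandt.matrix S.O) (fun n => W.LFunction n) =
      ℤ ∙ g) {i : ℤ}
    (hi : ∀ y ∈ X, i ∣ ∑ c, (Brandt.weight S.O c : ℤ) * g c * y c) : ¬ (p : ℤ) ∣ i := by
  classical
  obtain ⟨c₀, hc₀⟩ := Brandt.exists_not_dvd_of_eigenLattice_eq_span hg hL (Fact.out : p.Prime)
  obtain ⟨y, hy0, hy⟩ := exists_sum_eq_zero_not_dvd_pairing W hN h5 hsurj S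
    (hL ▸ Submodule.mem_span_singleton_self g) hc₀
  exact fun hp => hy (dvd_trans hp (hi y ((hX y).mpr hy0)))

/-! ### PW Thm. 6.8 for prime `N⁻`, from the character-group dictionary -/

/-- **Pollack–Weston 2011, Prop. 6.6 in Brandt coordinates: `ord_p δ = t(r) + ord_p ⟨g_r, g_r⟩`,
for one curve, one setup and abstract degree data.** Data, in the Brandt module `ℤ^{Cls O}` of
a setup `S` of type `(N⁺, N⁻)` (`N⁺N⁻ = N_E`) with Gross's pairing `Σ_c w_c x_c y_c`, for a prime
`r ∣ N_E` (exactly as in `Takahashi2001.exists_ij_of_brandtData`, plus `X = ℤ[Cls O]⁰`): the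
degree-zero sublattice `X` (the character group `𝒳_r` of `J = J₀^{N⁻/r}(N⁺r)` at `r`; Ribet 1990
Prop. 3.1 for `N⁻ = r`, Kohel / PW Prop. 6.5 in general), `pb = ξ^* : ℤ → X`, `pf = ξ_* : X → ℤ`
adjoint for `u_A(a, b) = c_r a b`, `c_r = ord_r Δ_min(E)` (`p^{t(r)} ∥ c_r`), with
`ξ_* ξ^* = δ` (`δ = δ_f(N⁺r, N⁻/r) > 0`, an abstract natural number here), `ξ_*` surjective
(optimality), and `ξ^* 1 = j g` for a generator `g ∈ X` of the `a(E)`-eigen-line. If `ρ̄_{E,p}`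
is surjective (CR (i)) and `p ≥ 5`, then `ord_p δ = ord_p ξ_S(E; N⁺, N⁻) + ord_p(ord_r Δ_min(E))`.
Proof (PW §6.4): Takahashi's `δ i = h_r |j|`, `i |j| = c_r`, `h_r = u_J(g,g) = Σ w_c g_c² = ξ_S`
(`Takahashi2001.exists_index_formula`, `xi_lFunction_eq_sum`), and `p ∤ i`
(`not_dvd_generator_range_pairing`, the non-Eisenstein step), so
`ord_p δ = ord_p h_r + ord_p |j| = ord_p ξ_S + ord_p c_r`. CR (ii) and `p ∤ N` are not needed.
[cite: PollackWeston2011, Prop. 6.6 (PDF p. 15)] [cite: Takahashi2001, Thm. 2.3] -/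
theorem factorization_eq_of_brandtData (W : WeierstrassCurve ℚ) [W.IsElliptic]
    {Nplus Nminus : ℕ} (hN : W.conductorNorm ℤ = Nplus * Nminus) {r : ℕ} (hr : r.Prime)
    (hrN : r ∣ Nplus * Nminus) (p : ℕ) [Fact p.Prime] (h5 : 5 ≤ p)
    (hsurj : W.HasSurjectiveModNGaloisRep (p : ℤ)) (S : Brandt.XiSetup Nplus Nminus)
    [Fintype (Brandt.ClassSet S.O)] (X : Submodule ℤ (Brandt.ClassSet S.O → ℤ))
    (hX : ∀ y, y ∈ X ↔ ∑ c, y c = 0) (pb : ℤ →ₗ[ℤ] X) (pf : X →ₗ[ℤ] ℤ) (g : X) (j : ℤ)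
    {δ : ℕ} (hδ0 : 0 < δ)
    (hadj : ∀ (a : ℤ) (y : X),
      ∑ c, (Brandt.weight S.O c : ℤ) * (pb a : Brandt.ClassSet S.O → ℤ) c *
          (y : Brandt.ClassSet S.O → ℤ) c =
        ((W.minimalDiscriminantNorm ℤ).factorization r : ℤ) * a * pf y)
    (hδ : ∀ a : ℤ, pf (pb a) = (δ : ℤ) * a) (hsurjpf : Function.Surjective pf)
    (hg : pb 1 = j • g)
    (hL : Brandt.eigenLattice (Nplus * Nminus) (Brandt.matrix S.O) (fun n => W.LFunction n) =
      ℤ ∙ (g : Brandt.ClassSet S.O → ℤ)) :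
    δ.factorization p =
      (S.xi fun n => W.LFunction n).factorization p +
        ((W.minimalDiscriminantNorm ℤ).factorization r).factorization p := by
  classical
  set c : ℕ := (W.minimalDiscriminantNorm ℤ).factorization r with hc_def
  set ξ : ℕ := S.xi fun n => W.LFunction n with hξ_def
  -- `c_r = ord_r Δ_min > 0`: `r ∣ N_E ∣ Δ_min ≠ 0`
  have hc0 : 0 < c := by
    have hfin := WeierstrassCurve.finite_setOf_ordMinimalDiscriminant_ne_zero_holds (A := ℤ) W
    have hdvd : W.conductorNorm ℤ ∣ W.minimalDiscriminantNorm ℤ :=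
      W.conductorNorm_dvd_minimalDiscriminantNorm hfin
    have hpos : 0 < W.minimalDiscriminantNorm ℤ := W.minimalDiscriminantNorm_pos_holds
    have hrd : r ∣ W.minimalDiscriminantNorm ℤ := dvd_trans (hN ▸ hrN) hdvd
    exact hr.factorization_pos_of_dvd hpos.ne' hrd
  -- Gross's pairing on `ℤ^{Cls O}`, its restriction `u_J` to `X`, and `u_E(a, b) = c a b` on `ℤ`
  let B : (Brandt.ClassSet S.O → ℤ) →ₗ[ℤ] (Brandt.ClassSet S.O → ℤ) →ₗ[ℤ] ℤ :=
    LinearMap.mk₂ ℤ (fun x y => ∑ i, (Brandt.weight S.O i : ℤ) * x i * y i)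
      (fun x₁ x₂ y => by
        simp only [Pi.add_apply, mul_add, add_mul, Finset.sum_add_distrib])
      (fun a x y => by
        simp only [Pi.smul_apply, smul_eq_mul, Finset.mul_sum]
        exact Finset.sum_congr rfl fun i _ => by ring)
      (fun x y₁ y₂ => by
        simp only [Pi.add_apply, mul_add, Finset.sum_add_distrib])
      (fun a x y => by
        simp only [Pi.smul_apply, smul_eq_mul, Finset.mul_sum]
        exact Finset.sum_congr rfl fun i _ => by ring)
  have hB : ∀ x y : Brandt.ClassSet S.O → ℤ, B x y = ∑ i, (Brandt.weight S.O i : ℤ) * x i * y i :=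
    fun x y => rfl
  let uJ : X →ₗ[ℤ] X →ₗ[ℤ] ℤ := B.compl₁₂ X.subtype X.subtype
  have huJ : ∀ x y : X, uJ x y = ∑ i, (Brandt.weight S.O i : ℤ) *
      (x : Brandt.ClassSet S.O → ℤ) i * (y : Brandt.ClassSet S.O → ℤ) i := fun x y => by
    simp only [uJ, LinearMap.compl₁₂_apply, Submodule.coe_subtype, hB]
  let uE : ℤ →ₗ[ℤ] ℤ →ₗ[ℤ] ℤ :=
    LinearMap.mk₂ ℤ (fun a b => (c : ℤ) * a * b) (fun a₁ a₂ b => by ring)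
      (fun m a b => by simp only [smul_eq_mul]; ring) (fun a b₁ b₂ => by ring)
      (fun m a b => by simp only [smul_eq_mul]; ring)
  have huE : ∀ a b : ℤ, uE a b = (c : ℤ) * a * b := fun a b => rfl
  -- the hypotheses of the abstract theorem
  have hadj' : ∀ (a : ℤ) (y : X), uJ (pb a) y = uE a (pf y) := fun a y => by
    rw [huJ, huE, ← hadj a y]
  have hδ' : ∀ a : ℤ, pf (pb a) = (δ : ℤ) • a := fun a => by rw [hδ a, smul_eq_mul]
  have hgen : ∀ x : ℤ, ∃ m : ℤ, m • (1 : ℤ) = x := fun x => ⟨x, by rw [smul_eq_mul, mul_one]⟩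
  have hc' : 0 < uE 1 1 := by rw [huE, mul_one, mul_one]; exact_mod_cast hc0
  -- `g ≠ 0` (as `π_* π^* 1 = δ ≠ 0`), so `ξ_S = Σ w_i g_i²`
  have hg0 : (g : Brandt.ClassSet S.O → ℤ) ≠ 0 := by
    intro h0
    have hg' : g = 0 := by ext i; exact congrFun h0 i
    have h1 := hδ 1
    rw [hg, hg', smul_zero, map_zero, mul_one] at h1
    exact hδ0.ne' (by exact_mod_cast h1.symm)
  have hxi : ξ = ∑ i, Brandt.weight S.O i * ((g : Brandt.ClassSet S.O → ℤ) i).natAbs ^ 2 :=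
    xi_lFunction_eq_sum W S hg0 hL
  have hh : uJ g g = (ξ : ℤ) := by
    rw [hxi, huJ, Nat.cast_sum]
    exact Finset.sum_congr rfl fun i _ => by push_cast; rw [sq_abs]; ring
  -- Takahashi: `range u_J(g, ·) = (i)`, `i |j| = c`, `δ i = h |j|`
  obtain ⟨i, hi, hI, hij, -, hδi⟩ :=
    Takahashi2001.exists_index_formula uJ uE pb pf hadj' hδ' hsurjpf hgen hc' hg
  rw [huE, mul_one, mul_one] at hij
  rw [hh] at hδi
  -- the non-Eisenstein step: `p ∤ i`
  have hpi : ¬ (p : ℤ) ∣ i := by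
    refine not_dvd_generator_range_pairing W hN h5 hsurj S X hX hg0 hL fun y hy => ?_
    have hmem : uJ g ⟨y, hy⟩ ∈ LinearMap.range (uJ g) := LinearMap.mem_range_self _ _
    rw [hI, Ideal.mem_span_singleton, huJ] at hmem
    exact hmem
  have hpi' : ¬ p ∣ i := fun h => hpi (Int.natCast_dvd_natCast.mpr h)
  -- arithmetic: `δ i = ξ |j|`, `i |j| = c`, `p ∤ i`
  have hj0 : j.natAbs ≠ 0 := by
    intro h0
    rw [Int.natAbs_eq_zero] at h0
    rw [h0, abs_zero, mul_zero] at hij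
    exact hc0.ne' (by exact_mod_cast hij.symm)
  have h1 : δ * i = ξ * j.natAbs := by
    have : ((δ * i : ℕ) : ℤ) = ((ξ * j.natAbs : ℕ) : ℤ) := by
      rw [Nat.cast_mul, Nat.cast_mul, Int.natCast_natAbs, hδi]
    exact_mod_cast this
  have h2 : i * j.natAbs = c := by
    have : ((i * j.natAbs : ℕ) : ℤ) = (c : ℤ) := by rw [Nat.cast_mul, Int.natCast_natAbs, hij]
    exact_mod_cast this
  have hξ0 : ξ ≠ 0 := by
    intro h0
    rw [h0, zero_mul] at h1
    exact (Nat.mul_pos hδ0 hi).ne' h1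
  have hfi : i.factorization p = 0 := Nat.factorization_eq_zero_of_not_dvd hpi'
  have e1 := congrArg (fun f => f p) (Nat.factorization_mul hδ0.ne' hi.ne')
  have e2 := congrArg (fun f => f p) (Nat.factorization_mul hξ0 hj0)
  have e3 := congrArg (fun f => f p) (Nat.factorization_mul hi.ne' hj0)
  simp only [Finsupp.add_apply] at e1 e2 e3
  rw [h1] at e1
  rw [h2] at e3
  omega

/-- **PW Thm. 6.8 (degree form) for a PRIME `N⁻ = r`, one curve, one setup, from the
dictionary**, in the shape of the conclusion of `PollackWeston2011.thm_6_8_ellipticCurve` at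
`(Nplus, Nminus) = (M, r)`: here `J = J₀(Mr)` (`(N₁,N₂) = (N,1)`, Ribet–Takahashi is empty),
`δ = deg P` is the optimal modular degree, `ξ(E; M, r) = brandtXi M r (a(E))` (the value on the
chosen setup equals `ξ_S` for every `S`, `Brandt.XiSetup.brandtXi_eq_xi`), and the sum runs over
the single prime factor of `r`. From `factorization_eq_of_brandtData`.
[cite: PollackWeston2011, Thm. 6.8 and Prop. 6.6 (PDF p. 15)] -/
theorem factorization_modularDegree_of_brandtData (W : WeierstrassCurve ℚ) [W.IsElliptic]
    (M r : ℕ) [NeZero (M * r)] (hr : r.Prime) (hN : W.conductorNorm ℤ = M * r)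
    (p : ℕ) [Fact p.Prime] (h5 : 5 ≤ p) (hsurj : W.HasSurjectiveModNGaloisRep (p : ℤ))
    (P : ModularParametrizationData W (M * r)) (S : Brandt.XiSetup M r)
    [Fintype (Brandt.ClassSet S.O)] (X : Submodule ℤ (Brandt.ClassSet S.O → ℤ))
    (hX : ∀ y, y ∈ X ↔ ∑ c, y c = 0) (pb : ℤ →ₗ[ℤ] X) (pf : X →ₗ[ℤ] ℤ) (g : X) (j : ℤ)
    (hadj : ∀ (a : ℤ) (y : X),
      ∑ c, (Brandt.weight S.O c : ℤ) * (pb a : Brandt.ClassSet S.O → ℤ) c *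
          (y : Brandt.ClassSet S.O → ℤ) c =
        ((W.minimalDiscriminantNorm ℤ).factorization r : ℤ) * a * pf y)
    (hδ : ∀ a : ℤ, pf (pb a) = (P.modularDegree : ℤ) * a) (hsurjpf : Function.Surjective pf)
    (hg : pb 1 = j • g)
    (hL : Brandt.eigenLattice (M * r) (Brandt.matrix S.O) (fun n => W.LFunction n) =
      ℤ ∙ (g : Brandt.ClassSet S.O → ℤ)) :
    P.modularDegree.factorization p =
      (brandtXi M r fun n => W.LFunction n).factorization p +
        ∑ q ∈ r.primeFactors, ((W.minimalDiscriminantNorm ℤ).factorization q).factorization p := by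
  rw [S.brandtXi_eq_xi, Nat.Prime.primeFactors hr, Finset.sum_singleton]
  exact factorization_eq_of_brandtData W hN hr (dvd_mul_left r M) p h5 hsurj S X hX pb pf g j
    P.deg_pos hadj hδ hsurjpf hg hL

/-- **`PollackWeston2011.thm_6_8_ellipticCurve` for prime `N⁻`, from the character-group
dictionary.** The hypothesis `H` is the geometric input (M1)–(M5) of
`TakahashiDegreeFormulaProofs.lean` in the coordinates of a Brandt setup — literally the hypothesis
of `takahashi2001_thm_2_3_of_brandtDictionary` with the additional clause, part of Ribet's
description as printed (Ribet 1990 Prop. 3.1; Takahashi 2001 p. 84: "the group of degree-0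
divisors on the set of isomorphism classes …"), that `X` is the degree-zero sublattice
`ℤ[Cls O]⁰`. Given `H`, for every elliptic `W/ℚ` of squarefree conductor `N = M r` with `r` PRIME,
every prime `p ≥ 5` with `ρ̄_{E,p}` surjective, and every parametrisation datum `D` at level `N` of
minimal degree among all data with the same newform (the optimal curve):
`ord_p(deg D) = ord_p ξ(E; M, r) + Σ_{q ∣ r} ord_p(ord_q Δ_min(E))` — the conclusion of the named
fact at `(Nplus, Nminus) = (M, r)`, with its hypotheses `p ∤ N` and CR (ii) not even needed. What
is NOT obtained this way: composite `N⁻` (Kohel's Prop. 6.5 for `𝒳_r(N⁺r, N⁻/r)` with `N⁻/r ≠ 1`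
and Ribet–Takahashi's comparison of Shimura-curve degrees). [cite: PollackWeston2011, Thm. 6.8 and Prop. 6.6 (PDF p. 15)] [cite: Ribet1990, §3 Prop. 3.1, Thm. 3.12] -/
theorem thm_6_8_prime_of_brandtDictionary
    (H : ∀ (W : WeierstrassCurve ℚ) [W.IsElliptic] (M r : ℕ) [NeZero (M * r)],
      r.Prime → Squarefree (M * r) → W.conductorNorm ℤ = M * r →
      ∀ P : ModularParametrizationData W (M * r),
        (∀ (W' : WeierstrassCurve ℚ) [W'.IsElliptic] (P' : ModularParametrizationData W' (M * r)),
            P'.f = P.f → P.modularDegree ≤ P'.modularDegree) →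
        ∀ (S : Brandt.XiSetup M r) [Fintype (Brandt.ClassSet S.O)],
          ∃ (X : Submodule ℤ (Brandt.ClassSet S.O → ℤ)) (pb : ℤ →ₗ[ℤ] X) (pf : X →ₗ[ℤ] ℤ)
            (g : X) (j : ℤ),
            (∀ y, y ∈ X ↔ ∑ c, y c = 0) ∧
            (∀ (a : ℤ) (y : X),
                ∑ i, (Brandt.weight S.O i : ℤ) * (pb a : Brandt.ClassSet S.O → ℤ) i *
                    (y : Brandt.ClassSet S.O → ℤ) i =
                  ((W.minimalDiscriminantNorm ℤ).factorization r : ℤ) * a * pf y) ∧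
            (∀ a : ℤ, pf (pb a) = (P.modularDegree : ℤ) * a) ∧
            Function.Surjective pf ∧
            pb 1 = j • g ∧
            Brandt.eigenLattice (M * r) (Brandt.matrix S.O) (fun n => W.LFunction n) =
              ℤ ∙ (g : Brandt.ClassSet S.O → ℤ))
    (W : WeierstrassCurve ℚ) [W.IsElliptic] (M r : ℕ) [NeZero (M * r)] (hr : r.Prime)
    (hN : W.conductorNorm ℤ = M * r) (hsq : Squarefree (M * r)) (p : ℕ) (hp : p.Prime)
    (h5 : 5 ≤ p) (hsurj : W.HasSurjectiveModNGaloisRep (p : ℤ))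
    (D : ModularParametrizationData W (M * r))
    (hmin : ∀ (W' : WeierstrassCurve ℚ) [W'.IsElliptic] (D' : ModularParametrizationData W' (M * r)),
      D'.f = D.f → D.modularDegree ≤ D'.modularDegree) :
    D.modularDegree.factorization p =
      (brandtXi M r fun n => W.LFunction n).factorization p +
        ∑ q ∈ r.primeFactors, ((W.minimalDiscriminantNorm ℤ).factorization q).factorization p := by
  classical
  haveI : Fact p.Prime := ⟨hp⟩
  have hodd : Odd r.primeFactors.card := by
    rw [Nat.Prime.primeFactors hr, Finset.card_singleton]; exact odd_one
  obtain ⟨S⟩ : Nonempty (Brandt.XiSetup M r) := Brandt.nonempty_xiSetup_of_squarefree_mul hsq hodd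
  letI : Fintype (Brandt.ClassSet S.O) := Fintype.ofFinite _
  obtain ⟨X, pb, pf, g, j, hX, hadj, hδ, hsurjpf, hg, hL⟩ := H W M r hr hsq hN D hmin S
  exact factorization_modularDegree_of_brandtData W M r hr hN p h5 hsurj D S X hX pb pf g j hadj hδ
    hsurjpf hg hL

/-- **The same dictionary still yields Takahashi's named fact** `takahashi2001_thm_2_3` (drop the
degree-zero clause and apply `takahashi2001_thm_2_3_of_brandtDictionary`): for prime `N⁻` the two
named facts `takahashi2001_thm_2_3` and (the prime case of) `PollackWeston2011.thm_6_8_ellipticCurve`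
rest on one and the same missing geometric input. [cite: Takahashi2001, Thm. 2.3 and p. 84] -/
theorem takahashi2001_thm_2_3_of_brandtDictionary_degreeZero
    (H : ∀ (W : WeierstrassCurve ℚ) [W.IsElliptic] (M r : ℕ) [NeZero (M * r)],
      r.Prime → Squarefree (M * r) → W.conductorNorm ℤ = M * r →
      ∀ P : ModularParametrizationData W (M * r),
        (∀ (W' : WeierstrassCurve ℚ) [W'.IsElliptic] (P' : ModularParametrizationData W' (M * r)),
            P'.f = P.f → P.modularDegree ≤ P'.modularDegree) →
        ∀ (S : Brandt.XiSetup M r) [Fintype (Brandt.ClassSet S.O)],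
          ∃ (X : Submodule ℤ (Brandt.ClassSet S.O → ℤ)) (pb : ℤ →ₗ[ℤ] X) (pf : X →ₗ[ℤ] ℤ)
            (g : X) (j : ℤ),
            (∀ y, y ∈ X ↔ ∑ c, y c = 0) ∧
            (∀ (a : ℤ) (y : X),
                ∑ i, (Brandt.weight S.O i : ℤ) * (pb a : Brandt.ClassSet S.O → ℤ) i *
                    (y : Brandt.ClassSet S.O → ℤ) i =
                  ((W.minimalDiscriminantNorm ℤ).factorization r : ℤ) * a * pf y) ∧
            (∀ a : ℤ, pf (pb a) = (P.modularDegree : ℤ) * a) ∧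
            Function.Surjective pf ∧
            pb 1 = j • g ∧
            Brandt.eigenLattice (M * r) (Brandt.matrix S.O) (fun n => W.LFunction n) =
              ℤ ∙ (g : Brandt.ClassSet S.O → ℤ)) :
    takahashi2001_thm_2_3 := by
  refine takahashi2001_thm_2_3_of_brandtDictionary fun W _ M r _ hr hsq hN P hmin S _ => ?_
  obtain ⟨X, pb, pf, g, j, -, hadj, hδ, hsurjpf, hg, hL⟩ := H W M r hr hsq hN P hmin S
  exact ⟨X, pb, pf, g, j, hadj, hδ, hsurjpf, hg, hL⟩

/-! ### The named fact from the dictionary for `𝒳_r(N⁺r, N⁻/r)` and Ribet–Takahashi -/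

/-- For a squarefree `n` and a prime `r ∣ n`, a sum over the prime factors of `n` splits off the
term at `r`, the rest running over the prime factors of `n / r`. [folklore] -/
theorem sum_primeFactors_eq_add_sum_div {n r : ℕ} (hn : Squarefree n) (hr : r.Prime) (hrn : r ∣ n)
    (f : ℕ → ℕ) : ∑ q ∈ n.primeFactors, f q = f r + ∑ q ∈ (n / r).primeFactors, f q := by
  have hnr : n = r * (n / r) := (Nat.mul_div_cancel' hrn).symm
  have hcop : Nat.Coprime r (n / r) := Nat.coprime_of_squarefree_mul (hnr ▸ hn)
  have hdisj : Disjoint r.primeFactors (n / r).primeFactors := hcop.disjoint_primeFactors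
  conv_lhs => rw [hnr, hcop.primeFactors_mul]
  rw [Finset.sum_union hdisj, Nat.Prime.primeFactors hr, Finset.sum_singleton]

/-- **`PollackWeston2011.thm_6_8_ellipticCurve` from the character-group dictionary and
Ribet–Takahashi** — the printed proof of Thm. 6.8 (§6.5) with every step that the tree supports
carried out, and the two absent geometric inputs taken as hypotheses about an abstract
Shimura-curve degree `δ' W N⁺ N⁻ r` (PW's `δ_f(N⁺r, N⁻/r)`, §6.2):
* `HK` — **Kohel's Prop. 6.5 with the character-group data of §6.2 for `J = J₀^{N⁻/r}(N⁺r)` at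
  `r ∣ N⁻`**, in the coordinates of a Brandt setup `S` of type `(N⁺, N⁻)`
  (`Pic(X_{N⁺,N⁻}) ⊗ 𝒪 ≅ 𝒳_r(N⁺r, N⁻/r)`, intersection pairing ↦ monodromy pairing = Gross's
  `Σ_c w_c x_c y_c` on the degree-zero part): for the optimal datum `P` and each `r ∣ N⁻`, the
  degree-zero sublattice `X`, `ξ^* : ℤ → X`, `ξ_* : X → ℤ` adjoint for `u_A(a,b) = c_r a b`
  (`c_r = ord_r Δ_min`, Prop. 6.3: `Φ̂_r(A)` cyclic of order `|k|^{t(r)}`), `ξ_* ξ^* = δ'`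
  (§6.2), `ξ_*` surjective (optimality), `ξ^* 1 = j g` with `g` generating the `a(E)`-eigen-line
  (`𝒳̂^f` free of rank one; multiplicity one);
* `HRT` — **Ribet–Takahashi** [RT, T] as used on PDF p. 15:
  `ord_p(δ_f(N,1)/δ_f(N⁺r, N⁻/r)) = Σ_{q ∣ N⁻/r} t_f(q)`, under the hypotheses of Thm. 6.8.
Given these, the fact follows: Prop. 6.6 in Brandt coordinates with the non-Eisenstein step
(`factorization_eq_of_brandtData`: `ord_p δ' = ord_p ξ_S + t(r)`), `ξ_f(N⁺,N⁻) = ξ_S = brandtXi`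
(`Brandt.XiSetup.brandtXi_eq_xi`), a setup exists (`Brandt.nonempty_xiSetup_of_squarefree_mul`),
and `Σ_{q ∣ N⁻} = t(r) + Σ_{q ∣ N⁻/r}` (`N⁻` squarefree). PROVED; `HK`, `HRT` are not in the tree.
[cite: PollackWeston2011, Thm. 6.8, proof (PDF p. 15), with Props. 6.3, 6.5, 6.6] -/
theorem thm_6_8_of_dictionary (δ' : WeierstrassCurve ℚ → ℕ → ℕ → ℕ → ℕ)
    (HK : ∀ (W : WeierstrassCurve ℚ) [W.IsElliptic] (Nplus Nminus : ℕ) [NeZero (Nplus * Nminus)],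
      W.conductorNorm ℤ = Nplus * Nminus → Squarefree (Nplus * Nminus) →
      Odd Nminus.primeFactors.card →
      ∀ P : ModularParametrizationData W (Nplus * Nminus),
        (∀ (W' : WeierstrassCurve ℚ) [W'.IsElliptic]
            (P' : ModularParametrizationData W' (Nplus * Nminus)),
            P'.f = P.f → P.modularDegree ≤ P'.modularDegree) →
        ∀ r ∈ Nminus.primeFactors, ∀ (S : Brandt.XiSetup Nplus Nminus)
          [Fintype (Brandt.ClassSet S.O)],
          ∃ (X : Submodule ℤ (Brandt.ClassSet S.O → ℤ)) (pb : ℤ →ₗ[ℤ] X) (pf : X →ₗ[ℤ] ℤ)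
            (g : X) (j : ℤ),
            (∀ y, y ∈ X ↔ ∑ c, y c = 0) ∧
            0 < δ' W Nplus Nminus r ∧
            (∀ (a : ℤ) (y : X),
                ∑ i, (Brandt.weight S.O i : ℤ) * (pb a : Brandt.ClassSet S.O → ℤ) i *
                    (y : Brandt.ClassSet S.O → ℤ) i =
                  ((W.minimalDiscriminantNorm ℤ).factorization r : ℤ) * a * pf y) ∧
            (∀ a : ℤ, pf (pb a) = (δ' W Nplus Nminus r : ℤ) * a) ∧
            Function.Surjective pf ∧
            pb 1 = j • g ∧
            Brandt.eigenLattice (Nplus * Nminus) (Brandt.matrix S.O) (fun n => W.LFunction n) =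
              ℤ ∙ (g : Brandt.ClassSet S.O → ℤ))
    (HRT : ∀ (W : WeierstrassCurve ℚ) [W.IsElliptic] (Nplus Nminus : ℕ) [NeZero (Nplus * Nminus)],
      W.conductorNorm ℤ = Nplus * Nminus → Squarefree (Nplus * Nminus) →
      Odd Nminus.primeFactors.card →
      ∀ p : ℕ, p.Prime → 5 ≤ p → ¬ p ∣ Nplus * Nminus →
      W.HasSurjectiveModNGaloisRep (p : ℤ) →
      (∀ q ∈ Nminus.primeFactors, ((q : ZMod p) = 1 ∨ (q : ZMod p) = -1) →
        ¬ p ∣ (W.minimalDiscriminantNorm ℤ).factorization q) →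
      ∀ P : ModularParametrizationData W (Nplus * Nminus),
        (∀ (W' : WeierstrassCurve ℚ) [W'.IsElliptic]
            (P' : ModularParametrizationData W' (Nplus * Nminus)),
            P'.f = P.f → P.modularDegree ≤ P'.modularDegree) →
        ∀ r ∈ Nminus.primeFactors,
          P.modularDegree.factorization p = (δ' W Nplus Nminus r).factorization p +
            ∑ q ∈ (Nminus / r).primeFactors,
              ((W.minimalDiscriminantNorm ℤ).factorization q).factorization p) :
    Literature.NumberTheory.Automorphic.PollackWeston2011.thm_6_8_ellipticCurve := by
  intro W _ Nplus Nminus _ hN hsq hodd p hp h5 hpN hsurj hram D hmin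
  classical
  haveI : Fact p.Prime := ⟨hp⟩
  -- a prime `r ∣ N⁻` (there is one: `ω(N⁻)` is odd) and a Brandt setup of type `(N⁺, N⁻)`
  obtain ⟨r, hr⟩ : Nminus.primeFactors.Nonempty := by
    rw [← Finset.card_pos]
    exact hodd.pos
  obtain ⟨S⟩ : Nonempty (Brandt.XiSetup Nplus Nminus) :=
    Brandt.nonempty_xiSetup_of_squarefree_mul hsq hodd
  letI : Fintype (Brandt.ClassSet S.O) := Fintype.ofFinite _
  have hrp : r.Prime := Nat.prime_of_mem_primeFactors hr
  have hrN : r ∣ Nminus := Nat.dvd_of_mem_primeFactors hr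
  -- Prop. 6.6 with the non-Eisenstein step: `ord_p δ' = ord_p ξ_S + t(r)`
  obtain ⟨X, pb, pf, g, j, hX, hδ0, hadj, hδ, hsurjpf, hg, hL⟩ :=
    HK W Nplus Nminus hN hsq hodd D hmin r hr S
  have h66 := factorization_eq_of_brandtData W hN hrp (dvd_mul_of_dvd_right hrN Nplus) p h5 hsurj
    S X hX pb pf g j hδ0 hadj hδ hsurjpf hg hL
  -- Ribet–Takahashi and the bookkeeping `Σ_{q ∣ N⁻} = t(r) + Σ_{q ∣ N⁻/r}`
  rw [HRT W Nplus Nminus hN hsq hodd p hp h5 hpN hsurj hram D hmin r hr, h66, S.brandtXi_eq_xi,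
    sum_primeFactors_eq_add_sum_div (Squarefree.of_mul_right hsq) hrp hrN, add_assoc]

end PollackWeston

end Literature.NumberTheory.EllipticCurves

end
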